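import Literature.AlgebraicGeometry.Frobenioids.PadicFrobenioid
import Literature.AlgebraicGeometry.Frobenioids.ModelFrobenioidAmpleness
import Literature.AlgebraicGeometry.Frobenioids.ModelFrobenioidCofinal
import HarnessLib

/-!
# Frobenioids II, Example 1.1 (ii) / Theorem 1.2: arithmetic of the datum of a `p`-adic Frobenioid (PROOFS)

Mochizuki, *The geometry of Frobenioids II*, Kyushu J. Math. **62** (2008) 401–460, §1, Example 1.1 (ii)
p. 8 and the proof of Theorem 1.2, pp. 9–10 [cite: MochizukiFrdII2008, Thm 1.2 pp.9-10].

PROOF-ONLY companion of `PadicFrobenioid.lean` (abc-iut-L1-t4): for a datum `d : PadicFrd.Datum D p`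
(base functor `D → D₀`, monoprime subfunctor `Φ ⊆ Φ₀|_D`, fibre product `B = B₀|_D ×_{Φ₀^gp|_D} Φ^gp`
with nonzero `B → Φ^gp`) we extract the arithmetic facts that the printed proof of Theorem 1.2 uses
"immediately from the construction of a model Frobenioid":
* (L1) `B(A)` is a group: every element is a unit (`Datum.isUnit_B`), and elements of `B(A)` with
  prescribed compatible images in `K^×` and `Φ^gp(A)` exist (`Datum.exists_B_of_compat`);
* (L2) **cofinality of `Div_B`** — "since the image monoids of this homomorphism are assumed to be
  nonzero, and `Φ` is monoprime" (p. 9): every class of `Φ(A)^gp` becomes effective after adding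
  `Div_B` of some element of `B(A)` (`Datum.divB_cofinal`, the instance of abc-iut-L1-d8's generic
  `ModelFrobenioid.divB_cofinal` of `ModelFrobenioidCofinal.lean`);
* (L3) the transports `Φ(f)`, `B(f)` along an arrow `f` of `D` depend only on its image in `D₀`
  (`Datum.mapΦ_eq_of_baseMap_eq`, `Datum.mapB_eq_of_baseMap_eq`) — the mechanism of Thm. 1.2 (ii),
  first clause; for the second (faithfulness) clause: elements of `B(A)` over a unit of `O_{K_A}`
  (`Datum.exists_B_over_unit`), the base-identity linear endomorphism `(1, id, 0, u)` they define
  (`ModelFrobenioid.exists_end_of_divB_eq_one`) and the converse of d8's conjugation formula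
  (`ModelFrobenioid.mapB_unit_eq_of_conj_eq`: equal conjugates ⇒ equal transports `B(Base α)(u)`);
* (L4) "if `Φ` is absolutely primitive, then the homomorphism `B → Φ^gp` … is surjective" (p. 9)
  (`Datum.divB_surjective_of_isAbsolutelyPrimitive`);
* (L5) `Φ(A) ≠ 0` (`Datum.exists_ne_one`) — "not of group-like type".
Split of node FrdII:Thm1.2 (L1-lead HELD 19:48:20Z): this file + (v) + (i) 2nd sentence = seat
abc-iut-L1-d10; generic model-Frobenioid files + (ii)(iii)(iv) = seat abc-iut-L1-d8. No new definitions;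
nothing here bears on [IUTchIII].
-/

namespace Literature.AlgebraicGeometry.Frobenioids

open CategoryTheory Opposite Function

universe v u

/-! ### Two generic complements to `ModelFrobenioidAmpleness.lean` (for Thm. 1.2 (ii), faithfulness) -/

section Generic

variable {M : Type u} [CommMonoid M]

/-- If `M^gp` has an element `≠ 0` then `M` has an element `≠ 0`. [cite: MochizukiFrdI2008, §0 p.11] -/
theorem GrothendieckGroup.exists_ne_one_of_ne_one {γ : Algebra.GrothendieckGroup M} (hγ : γ ≠ 1) :
    ∃ x : M, x ≠ 1 := by
  by_contra h
  have h' : ∀ x : M, x = 1 := fun x => not_ne_iff.mp (not_exists.mp h x)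
  obtain ⟨a, b, hab⟩ := grothendieckGroup_exists_mul_of_eq_of γ
  rw [h' a, h' b, map_one, mul_one] at hab
  exact hγ hab

end Generic

namespace ModelFrobenioid

variable {D : Type u} [Category.{v} D] {Φ B : Dᵒᵖ ⥤ CommMonCat.{u}} {DivB : B ⟶ monoidGp Φ}

/-- The base-identity linear endomorphism `(1, id, 0, u)` of `(A_D, α)` defined by an element
`u ∈ Ker(Div_B) ⊆ B(A_D)` exists (it lies in `O^×(A) ⊆ O^▷(A)`). [cite: MochizukiFrdI2008, Thm. 5.2(i) p.100] -/
theorem exists_end_of_divB_eq_one (X : ModelFrobenioid Φ B DivB) (u : B.obj (op X.base))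
    (hu : divB Φ B DivB (op X.base) u = 1) :
    ∃ f : X ⟶ X, degFr f = 1 ∧ baseMap f = 𝟙 X.base ∧ div f = 1 ∧ unit f = u :=
  ⟨{ degFr := 1, base := 𝟙 X.base, div := 1, unit := u,
     rel := by rw [PNat.one_coe, pow_one, map_one, mul_one, hu, mul_one, pullGp_id] },
    rfl, rfl, rfl, rfl⟩

/-- Converse use of the conjugation formula (`unit_conj`, abc-iut-L1-d8): if two automorphisms `α, β`
of `X` conjugate a base-identity linear endomorphism `f` to the same endomorphism, then their base arrows
transport `u_f` identically: `B(Base α)(u_f) = B(Base β)(u_f)` — the step "this factorization determines a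
faithful action" of FrdII Thm. 1.2 (ii). [cite: MochizukiFrdII2008, Thm 1.2 (ii) p.9] -/
theorem mapB_unit_eq_of_conj_eq {X : ModelFrobenioid Φ B DivB} (α β : X ≅ X) (f : X ⟶ X)
    (hf₁ : degFr f = 1) (hf₂ : baseMap f = 𝟙 X.base) (h : α.hom ≫ f ≫ α.inv = β.hom ≫ f ≫ β.inv) :
    (B.map (baseMap α.hom).op).hom (unit f) = (B.map (baseMap β.hom).op).hom (unit f) := by
  rw [← unit_conj α f hf₁ hf₂, ← unit_conj β f hf₁ hf₂, h]

end ModelFrobenioid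

namespace PadicFrd

namespace Datum

variable {D : Type u} [Category.{v} D] {p : ℕ} [Fact p.Prime] (d : Datum D p)

/-! ### (L1) The fibre product `B(A) = K_A^× ×_{Φ₀^gp(A)} Φ^gp(A)` -/

/-- `Div_B` at `A` in the form used by `ModelFrobenioid` (`divB Φ B Div_B A`) is the component of the
datum's `divB` (definitional). [cite: MochizukiFrdII2008, Ex 1.1 (ii) p.8] -/
theorem divB_apply (A : Dᵒᵖ) (u : d.B.obj A) :
    Frobenioids.divB d.Φ d.B d.divB A u = (d.divB.app A).hom u := rfl

/-- The cartesian square of the datum, evaluated at `b ∈ B(A)` and written over the concrete groups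
`K_A^×` and `Φ^gp(A)`: `Div₀(b|_{K^×}) = ι^gp(Div_B(b))` in `Φ₀^gp(A)`. [cite: MochizukiFrdII2008, Ex 1.1 (ii) p.8] -/
theorem square_apply (A : Dᵒᵖ) (b : d.B.obj A) :
    divZeroHom (d.fld A.unop) ((d.toB0.app A).hom b) =
      MonGp.map (d.ι.app A).hom (Frobenioids.divB d.Φ d.B d.divB A b) :=
  congrArg (fun f : d.B ⟶ monoidGp (phiZeroOn d.base) => (f.app A).hom b) d.square

/-- Two elements of `B(A)` with the same components in `K_A^×` and `Φ^gp(A)` are equal (injectivity half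
of `cartesian`). [cite: MochizukiFrdII2008, Ex 1.1 (ii) p.8] -/
theorem B_ext (A : Dᵒᵖ) {u u' : d.B.obj A} (h₁ : (d.toB0.app A).hom u = (d.toB0.app A).hom u')
    (h₂ : Frobenioids.divB d.Φ d.B d.divB A u = Frobenioids.divB d.Φ d.B d.divB A u') : u = u' :=
  (d.cartesian A).1 (Subtype.ext (Prod.ext h₁ h₂))

/-- **(L1)** Elements of `B(A)` with prescribed compatible components exist (surjectivity half of
`cartesian`): for `x ∈ K_A^×` and `γ ∈ Φ^gp(A)` with the same image in `Φ₀^gp(A)` there is `u ∈ B(A)`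
over `(x, γ)`. [cite: MochizukiFrdII2008, Ex 1.1 (ii) p.8] -/
theorem exists_B_of_compat (A : Dᵒᵖ) (x : (d.fld A.unop)ˣ) (γ : Algebra.GrothendieckGroup (d.Φ.obj A))
    (h : divZeroHom (d.fld A.unop) x = MonGp.map (d.ι.app A).hom γ) :
    ∃ u : d.B.obj A, (d.toB0.app A).hom u = x ∧ Frobenioids.divB d.Φ d.B d.divB A u = γ := by
  obtain ⟨u, hu⟩ := (d.cartesian A).2 ⟨(x, γ), h⟩
  exact ⟨u, congrArg (fun q => q.1.1) hu, congrArg (fun q => q.1.2) hu⟩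

/-- **(L1)** `B(A)` is a group: every element of `B(A) = K_A^× ×_{Φ₀^gp(A)} Φ^gp(A)` is a unit (the fibre
product of two groups over a group). [cite: MochizukiFrdII2008, Ex 1.1 (ii) p.8] -/
theorem isUnit_B (A : Dᵒᵖ) (b : d.B.obj A) : IsUnit b := by
  obtain ⟨x, hx⟩ : ∃ x : (d.fld A.unop)ˣ, (d.toB0.app A).hom b = x := ⟨_, rfl⟩
  have hc : divZeroHom (d.fld A.unop) x = MonGp.map (d.ι.app A).hom (Frobenioids.divB d.Φ d.B d.divB A b) := by
    rw [← hx]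
    exact d.square_apply A b
  obtain ⟨b', h₁, h₂⟩ := d.exists_B_of_compat A x⁻¹ (Frobenioids.divB d.Φ d.B d.divB A b)⁻¹
    (by rw [map_inv, map_inv]; exact congrArg (·⁻¹) hc)
  refine IsUnit.of_mul_eq_one b' (d.B_ext A ?_ ?_)
  · rw [map_mul, h₁, hx, map_one]
    exact mul_inv_cancel x
  · rw [map_mul, h₂, mul_inv_cancel, map_one]

/-- **(L5)** `Φ(A) ≠ 0`: some element of `Φ(A)` is nonzero ("for every `A`, the homomorphism
`B(A) → Φ^gp(A)` is nonzero" forces `Φ^gp(A) ≠ 0`). [cite: MochizukiFrdII2008, Thm 1.2 (i) p.9] -/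
theorem exists_ne_one (A : Dᵒᵖ) : ∃ x : d.Φ.obj A, x ≠ 1 := by
  obtain ⟨b, hb⟩ := d.nonzero A
  exact GrothendieckGroup.exists_ne_one_of_ne_one hb

/-! ### (L2) Cofinality of `Div_B` -/

/-- **(L2) Cofinality of `Div_B`** for the datum (proof of FrdII Thm. 1.2 (i)/(iii): "`Φ` is monoprime"
+ "the image monoids … are nonzero" + (L1)), as the instance of abc-iut-L1-d8's generic
`ModelFrobenioid.divB_cofinal`: every class `γ ∈ Φ(A)^gp` becomes effective after adding `Div_B(u)`
for a suitable `u ∈ B(A)`. [cite: MochizukiFrdII2008, Thm 1.2 (i) p.9] -/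
theorem divB_cofinal (A : D) (γ : Algebra.GrothendieckGroup (d.Φ.obj (op A))) :
    ∃ (z : d.Φ.obj (op A)) (u : d.B.obj (op A)),
      γ * Frobenioids.divB d.Φ d.B d.divB (op A) u = Algebra.GrothendieckGroup.of z :=
  ModelFrobenioid.divB_cofinal A (d.isMonoprime (op A)) (d.isUnit_B (op A)) (d.nonzero (op A)) γ

/-- **(L1′)** Elements of `B(A)` over the units of `O_{K_A}`: for `x ∈ K_A^×` of valuation `1` there is
`u ∈ B(A)` over `(x, 0)`, i.e. with `u|_{K^×} = x` and `Div_B(u) = 0` (so `(1, id, 0, u) ∈ O^×(A)`).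
[cite: MochizukiFrdII2008, Thm 1.2 (ii) p.9] -/
theorem exists_B_over_unit (A : Dᵒᵖ) (x : (d.fld A.unop)ˣ) (hx : x ∈ unitSubgroup (d.fld A.unop)) :
    ∃ u : d.B.obj A, (d.toB0.app A).hom u = x ∧ Frobenioids.divB d.Φ d.B d.divB A u = 1 := by
  refine d.exists_B_of_compat A x 1 ?_
  have hx' : divUnits (d.fld A.unop) x = 1 := by
    rw [← MonoidHom.mem_ker, ker_divUnits]
    exact hx
  rw [map_one, divZeroHom, MonoidHom.comp_apply, hx', map_one]
  rfl

/-! ### (L3) Transports along `f` depend only on the image of `f` in `D₀` -/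

/-- **(L3)**, divisor monoid: if two arrows `f, f' : Y → X` of `D` have the same image in `D₀`, then
`Φ(f) = Φ(f')` (`Φ ⊆ Φ₀|_D` is a subfunctor). [cite: MochizukiFrdII2008, Thm 1.2 (ii) p.9] -/
theorem mapΦ_eq_of_baseMap_eq {X Y : D} (f f' : Y ⟶ X) (h : d.base.map f = d.base.map f') :
    d.Φ.map f.op = d.Φ.map f'.op := by
  apply CommMonCat.hom_ext
  refine MonoidHom.ext fun x => d.ι_injective (op Y) ?_
  have n := fun g : Y ⟶ X => congrArg (fun φ => φ.hom x) (d.ι.naturality g.op)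
  simp only [CommMonCat.hom_comp, MonoidHom.comp_apply] at n
  rw [n f, n f']
  change (phiZero p).map (d.base.map f).op _ = (phiZero p).map (d.base.map f').op _
  rw [h]

/-- **(L3″)** If the image of `g ∈ End_D(A)` in `D₀` acts trivially on `Φ₀(A₀) = ord(O_{K_A}^⊳) ⊗ ℝ_{≥0}`,
then `g` acts trivially on `Φ(A)` — the reduction of the printed sentence "the monoid `End_D(A_D)` acts
trivially on `Φ(A_D)`" (FrdII p. 9) to the base category `D₀`. [cite: MochizukiFrdII2008, Thm 1.2 (i) p.9] -/
theorem mapΦ_eq_id_of_phiZero_map_eq_id {X : D} (g : X ⟶ X)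
    (h : (phiZero p).map (d.base.map g).op = 𝟙 _) : d.Φ.map g.op = 𝟙 _ := by
  apply CommMonCat.hom_ext
  refine MonoidHom.ext fun x => d.ι_injective (op X) ?_
  have n := congrArg (fun φ => φ.hom x) (d.ι.naturality g.op)
  simp only [CommMonCat.hom_comp, MonoidHom.comp_apply] at n
  rw [n, CommMonCat.hom_id, MonoidHom.id_apply]
  change ((phiZero p).map (d.base.map g).op).hom _ = _
  rw [h]
  rfl

/-- **(L3)**, groupified: `Φ^gp(f) = Φ^gp(f')`. [cite: MochizukiFrdII2008, Thm 1.2 (ii) p.9] -/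
theorem pullGp_eq_of_baseMap_eq {X Y : D} (f f' : Y ⟶ X) (h : d.base.map f = d.base.map f') :
    pullGp d.Φ f = pullGp d.Φ f' := by
  change MonGp.map (d.Φ.map f.op).hom = MonGp.map (d.Φ.map f'.op).hom
  rw [d.mapΦ_eq_of_baseMap_eq f f' h]

/-- **(L3)**, rational function monoid: if `f, f' : Y → X` have the same image in `D₀`, then
`B(f) = B(f')` (`B(Y) = K_Y^× ×_{Φ₀^gp} Φ^gp(Y)` and both components of `B(f)(u)` depend only on the image
of `f`). [cite: MochizukiFrdII2008, Thm 1.2 (ii) p.9] -/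
theorem mapB_eq_of_baseMap_eq {X Y : D} (f f' : Y ⟶ X) (h : d.base.map f = d.base.map f') :
    d.B.map f.op = d.B.map f'.op := by
  apply CommMonCat.hom_ext
  refine MonoidHom.ext fun u => d.B_ext (op Y) ?_ ?_
  · have n := fun g : Y ⟶ X => congrArg (fun φ => φ.hom u) (d.toB0.naturality g.op)
    simp only [CommMonCat.hom_comp, MonoidHom.comp_apply] at n
    rw [n f, n f']
    change (bZero p).map (d.base.map f).op _ = (bZero p).map (d.base.map f').op _
    rw [h]
  · have n := fun g : Y ⟶ X => congrArg (fun φ => φ.hom u) (d.divB.naturality g.op)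
    simp only [CommMonCat.hom_comp, MonoidHom.comp_apply] at n
    change (d.divB.app (op Y)).hom _ = (d.divB.app (op Y)).hom _
    rw [n f, n f']
    change MonGp.map (d.Φ.map f.op).hom _ = MonGp.map (d.Φ.map f'.op).hom _
    rw [d.mapΦ_eq_of_baseMap_eq f f' h]

/-! ### (L4) Absolutely primitive data: `Div_B` is surjective -/

/-- For absolutely primitive `Φ`, every class of `Φ^gp(A)` maps into `ℤ · ord(p) ⊆ Φ₀^gp(A)`.
[cite: MochizukiFrdII2008, Thm 1.2 (v) p.9] -/
theorem mem_zpowers_of_isAbsolutelyPrimitive (hap : d.IsAbsolutelyPrimitive) (A : D)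
    (γ : Algebra.GrothendieckGroup (d.Φ.obj (op A))) :
    MonGp.map (d.ι.app (op A)).hom γ ∈
      Subgroup.zpowers (d.ordIntGp A (Associates.mk ⟨((p : ℕ) : d.fld A), (d.base.obj A).p_mem⟩)) := by
  obtain ⟨a, b, hab⟩ := grothendieckGroup_exists_mul_of_eq_of γ
  rw [(eq_div_iff_mul_eq'.mpr hab : γ = _ / _), map_div, MonGp.map_of, MonGp.map_of]
  exact Subgroup.div_mem _ (hap A a) (hap A b)

/-- **(L4)** "if `Φ` is absolutely primitive, then the homomorphism `B → Φ^gp` … is surjective"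
(proof of FrdII Thm. 1.2 (v), p. 9): a class `γ` with image `k · ord(p)` in `Φ₀^gp(A)` is `Div_B` of the
element of `B(A)` over `(p^k, γ)`. [cite: MochizukiFrdII2008, Thm 1.2 (v) p.9] -/
theorem divB_surjective_of_isAbsolutelyPrimitive (hap : d.IsAbsolutelyPrimitive) (A : D) :
    Surjective (Frobenioids.divB d.Φ d.B d.divB (op A)) := by
  intro γ
  obtain ⟨k, hk⟩ := Subgroup.mem_zpowers_iff.mp (d.mem_zpowers_of_isAbsolutelyPrimitive hap A γ)
  obtain ⟨u, -, hu⟩ := d.exists_B_of_compat (op A)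
    (intNonzeroToUnits (d.fld A) ⟨((p : ℕ) : d.fld A), (d.base.obj A).p_mem⟩ ^ k) γ (by
      rw [map_zpow, divZeroHom_intNonzeroToUnits]
      exact hk)
  exact ⟨u, hu⟩

end Datum

end PadicFrd

end Literature.AlgebraicGeometry.Frobenioids
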